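import Summits.AtomisticToContinuum.HydrodynamicLimit.Theorems.OneFlightGossipEngineCollisionActivityTailsActivityDomination
import Summits.AtomisticToContinuum.HydrodynamicLimit.Theorems.OneFlightGossipEngineCollisionActivityTailsNearFieldKineticMeasurable
import Summits.AtomisticToContinuum.HydrodynamicLimit.Theorems.OneFlightGossipEngineCollisionActivityTailsCfgCollisionSums
import HarnessLib

/-!
# `CollisionActivityTails` (stmt-AtomisticToContinuum-13734), line `SketchK1`: measurability of the
crowded-activity tail sum

Helper file (`--supports stmt-AtomisticToContinuum-13734`) for the crux
`Summit.AtomisticToContinuum.HydrodynamicLimit.Theses.TwoClocks.CollisionActivityTails`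
(≡ `…Theses.OneFlightGossipEngine.CollisionActivityTails`), skeleton line `SketchK1`, registered stub
`stub_crowdedActivityUI` (statement `CrowdedActivityUI`, §1b of the skeleton).

That stub asks, in the crux's own frame and quantifier shape, for two conjuncts about the CROWDED
COLLISIONAL ACTIVITY of a tagged sphere `i` over the window `(s, s + w]`, `w = τ (N+1)^{-1/3}`,
`ε = hsDiameter σ N`,

`Fcr_i(z) = (σ/τ) Σ_{collisions (t, k, l) of the orbit of z, t ∈ (s, s+w]}
   𝟙{dist(x_k(t), x_i(t)) ≤ 3ε, dist(x_l(t), x_i(t)) ≤ 3ε, #{j : dist(x_j(t), x_i(t)) ≤ 3ε} ≥ 3} · |v_k(t) − v_k(t⁻)|`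

(`crowdedActivity`, a `HardSphereFlow.collisionPairSum` whose summand sees the whole configuration at
the collision time):

* (measurability) `z ↦ Σ_i 𝟙{M < Fcr_i(z)} Fcr_i(z)` is a.e.-measurable for the local Gibbs law;
* (uniform integrability) `E[(N+1)⁻¹ Σ_i 𝟙{M < Fcr_i} Fcr_i] ≤ ε` in the UI shape — an a-priori estimate
  under the TRUE pre-shock law, OPEN (no `N`-uniform moment bound of order `> 1` on `Fcr` is known).

This file closes the FIRST conjunct once and for all (`aemeasurable_sum_tailFn_crowdedActivity`,
packaged as `CrowdedActivityMeasurable` / `stub_crowdedActivityMeasurable`), for every `σ, N`, every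
flow, every window and every cut-off, so that whoever proves the UI conjunct only has to supply the
estimate.

## The argument

The collision-sum measurability engine of the tree
(`Literature.Analysis.FluidPDE.EmpiricalCollisionMeasureMeasurable(Labels)`: velocity-jump detection
over the `2^n` dyadic cells of the window, time-slice measurability of the flow only) handles summands
that are CONTINUOUS functions of the collision MARK `(t, x_k, ω, v_k⁻, v_l⁻)`, in a hard-sphere
REGULAR geometry (`ε < 1/2` on the torus). The crowded summand is neither: it depends on the positions
of ALL spheres at the collision time, through the DISCONTINUOUS crowding indicator. Two additions:

* the configuration-aware engine (companion helper file `…CollisionActivityTailsCfgCollisionSums`,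
  registered sub-goal `stub_cfgCollisionSumMeasurable`): for a family `H k l` of continuous and
  measurable functions of `(time, configuration, configuration)`, the collision pair sum of
  `H k l (t, Φ_t z, Φ_{t⁻} z)` over the collisions of the orbit in `(a, b]`, extended by `0` off the good
  set, is measurable in `z`, for a torus flow at EVERY diameter (binary collisions in ordered form need
  only the symmetry of contact, `Torus.euclidDist_comm`) — hence no hypothesis on `σ` here;
* §1–§2 (the discontinuity, this file). The crowding indicator is the pointwise limit of the continuous
  weights `crowdWeightApprox (3ε) i k l m` (products of ramps `ramp` of the closed conditions
  `dist ≤ 3ε` and a clamp `step3` of the ramp count, `tendsto_crowdWeightApprox`), so on the good set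
  `Fcr_i` is the limit as `m → ∞` of `(σ/τ) ·` the collision pair sums of the continuous summands
  `crowdSummand (3ε) i m k l (t, y, y') = (weight at y) · |v_k(y) − v_k(y')|`
  (`tendsto_collisionPairSum_crowdSummand`; the recorded pre-collisional velocity is the left limit,
  `IsHardSphereTrajectory.ofConfig_preVel_eq_leftLim`), each measurable by the engine; a pointwise
  limit of measurable functions is measurable (`measurable_indicator_crowdedActivity`).

§3: the local Gibbs law is carried by the good set (`localGibbsLaw_compl_good`, p90029), so `Fcr_i` is
a.e.-measurable; `tailFn M` is measurable and finite sums preserve a.e.-measurability.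

References: I. Gallagher, L. Saint-Raymond, B. Texier, *From Newton to Boltzmann* (2013), §4.1
(collisions of the hard-sphere flow); C. Cercignani, R. Illner, M. Pulvirenti, *The Mathematical Theory
of Dilute Gases* (1994), §4.2, App. 4.A (measurability along the hard-sphere flow); H. Spohn, *Large
Scale Dynamics of Interacting Particles* (1991), Part I §2.3 (local Gibbs states).
-/

noncomputable section

open MeasureTheory Set Filter Topology Function
open scoped ENNReal

namespace Summit.AtomisticToContinuum.HydrodynamicLimit.Theorems.CollisionActivityTailsCrowdedActivityMeasurable

open Literature.MathematicalPhysics.KineticTheory Literature.Analysis.FluidPDE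
open Summit.AtomisticToContinuum.HydrodynamicLimit.Theorems.CollisionActivityTailsActivityDomination
open Summit.AtomisticToContinuum.HydrodynamicLimit.Theorems.CollisionActivityTailsNearFieldKineticTails (tailFn
  localGibbsLaw_compl_good)
open Summit.AtomisticToContinuum.HydrodynamicLimit.Theorems.CollisionActivityTailsCfgCollisionSums
  (measurable_indicator_collisionPairSum_cfg_torus)


/-! ## §1 Continuous approximation of the crowding indicator -/

section Scalar

/-- The ramp `x ↦ min 1 (max 0 (1 - (m+1)(x - R)))`: equal to `1` on `x ≤ R`, to `0` beyond
`R + 1/(m+1)`, continuous; it decreases to the indicator of `{x ≤ R}` as `m → ∞`. -/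
def ramp (R : ℝ) (m : ℕ) (x : ℝ) : ℝ := min 1 (max 0 (1 - ((m : ℝ) + 1) * (x - R)))

/-- On `x ≤ R` the ramp is `1`. -/
theorem ramp_of_le {R x : ℝ} (m : ℕ) (h : x ≤ R) : ramp R m x = 1 := by
  unfold ramp
  exact min_eq_left (le_max_of_le_right (by nlinarith [(by positivity : (0 : ℝ) ≤ (m : ℝ) + 1)]))

/-- Beyond `R + 1/(m+1)` the ramp vanishes. -/
theorem ramp_eq_zero_of_le {R x : ℝ} {m : ℕ} (h : 1 ≤ ((m : ℝ) + 1) * (x - R)) : ramp R m x = 0 := by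
  unfold ramp
  rw [max_eq_left (by linarith), min_eq_right zero_le_one]

/-- The ramp is continuous. -/
theorem continuous_ramp (R : ℝ) (m : ℕ) : Continuous (ramp R m) :=
  continuous_const.min (continuous_const.max (continuous_const.sub
    (continuous_const.mul (continuous_id.sub continuous_const))))

/-- The ramps converge pointwise to the indicator of the closed condition `{x ≤ R}`. -/
theorem tendsto_ramp (R x : ℝ) :
    Tendsto (fun m : ℕ => ramp R m x) atTop (𝓝 (if x ≤ R then 1 else 0)) := by
  split_ifs with hx
  · exact tendsto_const_nhds.congr fun m => (ramp_of_le m hx).symm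
  · have hxR : 0 < x - R := sub_pos.2 (not_le.1 hx)
    refine tendsto_const_nhds.congr' ?_
    filter_upwards [(tendsto_natCast_atTop_atTop (R := ℝ)).eventually_ge_atTop (1 / (x - R))]
      with m hm
    refine (ramp_eq_zero_of_le ?_).symm
    have h1 : 1 / (x - R) * (x - R) = 1 := one_div_mul_cancel hxR.ne'
    have h2 := mul_le_mul_of_nonneg_right hm hxR.le
    rw [h1] at h2
    linarith

/-- The clamp `c ↦ min 1 (max 0 (c - 2))`: continuous, and on natural numbers the indicator of
`{3 ≤ n}`. -/
def step3 (c : ℝ) : ℝ := min 1 (max 0 (c - 2))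

/-- The clamp is continuous. -/
theorem continuous_step3 : Continuous step3 :=
  continuous_const.min (continuous_const.max (continuous_id.sub continuous_const))

/-- On natural numbers the clamp is the indicator of `{3 ≤ n}`. -/
theorem step3_natCast (n : ℕ) : step3 n = if 3 ≤ n then 1 else 0 := by
  unfold step3
  split_ifs with h
  · have : (3 : ℝ) ≤ n := by exact_mod_cast h
    exact min_eq_left (le_max_of_le_right (by linarith))
  · have : (n : ℝ) ≤ 2 := by exact_mod_cast (by omega : n ≤ 2)
    rw [max_eq_left (by linarith), min_eq_right zero_le_one]

end Scalar

section Crowd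

variable {N : ℕ}

/-- The minimal-image distance of the centres of `j` and `i` is a continuous function of the
configuration (`Torus.continuous_norm_reprSym`; no bound on the distance is needed). -/
theorem continuous_tdist_config (j i : Fin (N + 1)) :
    Continuous fun y : Cfg N => tdist (y j).1 (y i).1 := by
  have hj : Continuous fun y : Cfg N => y j := continuous_apply j
  have hi : Continuous fun y : Cfg N => y i := continuous_apply i
  unfold tdist
  simp only [Torus.geometry_sepVec]
  exact Torus.continuous_norm_reprSym.comp (hj.fst.sub hi.fst)

/-- The distance of the centres of `j` and `i` is a measurable function of the configuration. -/
theorem measurable_tdist_config (j i : Fin (N + 1)) :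
    Measurable fun y : Cfg N => tdist (y j).1 (y i).1 :=
  (Torus.measurable_geometry_sepVec.comp
    ((measurable_pi_apply j).fst.prodMk (measurable_pi_apply i).fst)).norm

/-- The number of centres within distance `R` of the centre of `i`, as a real number, is the sum of
the indicators `𝟙{dist(x_j, x_i) ≤ R}`. -/
theorem natCast_nearCount (y : Cfg N) (i : Fin (N + 1)) (R : ℝ) :
    ((nearCount y i R : ℕ) : ℝ) = ∑ j, if tdist (y j).1 (y i).1 ≤ R then (1 : ℝ) else 0 := by
  unfold nearCount
  rw [Finset.card_filter]
  push_cast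
  rfl

/-- The continuous approximation of rank `m` of the CROWDING INDICATOR
`𝟙{dist(x_k, x_i) ≤ R} 𝟙{dist(x_l, x_i) ≤ R} 𝟙{3 ≤ #{j : dist(x_j, x_i) ≤ R}}` of the crowded-activity
summand: ramps of the two closed distance conditions times the clamp of the ramp count. -/
def crowdWeightApprox (R : ℝ) (i k l : Fin (N + 1)) (m : ℕ) (y : Cfg N) : ℝ :=
  ramp R m (tdist (y k).1 (y i).1) * ramp R m (tdist (y l).1 (y i).1) *
    step3 (∑ j, ramp R m (tdist (y j).1 (y i).1))

/-- The crowding weights are continuous functions of the configuration. -/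
theorem continuous_crowdWeightApprox (R : ℝ) (i k l : Fin (N + 1)) (m : ℕ) :
    Continuous (crowdWeightApprox (N := N) R i k l m) := by
  have hd : ∀ j : Fin (N + 1), Continuous fun y : Cfg N => ramp R m (tdist (y j).1 (y i).1) :=
    fun j => (continuous_ramp R m).comp (continuous_tdist_config j i)
  unfold crowdWeightApprox
  exact ((hd k).mul (hd l)).mul (continuous_step3.comp (continuous_finsetSum _ fun j _ => hd j))

/-- The crowding weights are measurable functions of the configuration. -/
theorem measurable_crowdWeightApprox (R : ℝ) (i k l : Fin (N + 1)) (m : ℕ) :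
    Measurable (crowdWeightApprox (N := N) R i k l m) := by
  have hd : ∀ j : Fin (N + 1), Measurable fun y : Cfg N => ramp R m (tdist (y j).1 (y i).1) :=
    fun j => (continuous_ramp R m).measurable.comp (measurable_tdist_config j i)
  unfold crowdWeightApprox
  exact ((hd k).mul (hd l)).mul (continuous_step3.measurable.comp
    (Finset.measurable_sum _ fun j _ => hd j))

/-- **The crowding weights converge pointwise to the crowding indicator** (each ramp converges to the
indicator of its closed condition, the ramp count to the integer count, on which the clamp is the
indicator of `{3 ≤ ·}`). -/
theorem tendsto_crowdWeightApprox (R : ℝ) (i k l : Fin (N + 1)) (y : Cfg N) :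
    Tendsto (fun m => crowdWeightApprox R i k l m y) atTop
      (𝓝 (if tdist (y k).1 (y i).1 ≤ R ∧ tdist (y l).1 (y i).1 ≤ R ∧ 3 ≤ nearCount y i R
        then 1 else 0)) := by
  have h3 : Tendsto (fun m : ℕ => step3 (∑ j, ramp R m (tdist (y j).1 (y i).1))) atTop
      (𝓝 (if 3 ≤ nearCount y i R then 1 else 0)) := by
    rw [← step3_natCast, natCast_nearCount]
    exact (continuous_step3.tendsto _).comp (tendsto_finsetSum _ fun j _ => tendsto_ramp R _)
  have h := ((tendsto_ramp R (tdist (y k).1 (y i).1)).mul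
    (tendsto_ramp R (tdist (y l).1 (y i).1))).mul h3
  unfold crowdWeightApprox
  convert h using 2
  by_cases hk : tdist (y k).1 (y i).1 ≤ R <;> by_cases hl : tdist (y l).1 (y i).1 ≤ R <;>
    by_cases hn : 3 ≤ nearCount y i R <;> simp [hk, hl, hn]

/-- The rank-`m` CONTINUOUS SUMMAND approximating the crowded-activity summand of the tagged sphere `i`:
`(t, y, y') ↦ (crowding weight of rank m at y for the pair (k, l)) · |v_k(y) − v_k(y')|` (`y` the post-,
`y'` the pre-collisional configuration). -/
def crowdSummand (R : ℝ) (i : Fin (N + 1)) (m : ℕ) (k l : Fin (N + 1))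
    (p : ℝ × Cfg N × Cfg N) : ℝ :=
  crowdWeightApprox R i k l m p.2.1 * ‖(p.2.1 k).2 - (p.2.2 k).2‖

/-- The rank-`m` summands are continuous. -/
theorem continuous_crowdSummand (R : ℝ) (i : Fin (N + 1)) (m : ℕ) (k l : Fin (N + 1)) :
    Continuous (crowdSummand (N := N) R i m k l) := by
  have hk : Continuous fun y : Cfg N => (y k).2 := (continuous_apply k).snd
  have h1 : Continuous fun p : ℝ × Cfg N × Cfg N => (p.2.1 k).2 := hk.comp continuous_snd.fst
  have h2 : Continuous fun p : ℝ × Cfg N × Cfg N => (p.2.2 k).2 := hk.comp continuous_snd.snd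
  unfold crowdSummand
  exact ((continuous_crowdWeightApprox R i k l m).comp continuous_snd.fst).mul (h1.sub h2).norm

/-- The rank-`m` summands are measurable. -/
theorem measurable_crowdSummand (R : ℝ) (i : Fin (N + 1)) (m : ℕ) (k l : Fin (N + 1)) :
    Measurable (crowdSummand (N := N) R i m k l) := by
  have hk : Measurable fun y : Cfg N => (y k).2 := (measurable_pi_apply k).snd
  have h1 : Measurable fun p : ℝ × Cfg N × Cfg N => (p.2.1 k).2 := hk.comp measurable_snd.fst
  have h2 : Measurable fun p : ℝ × Cfg N × Cfg N => (p.2.2 k).2 := hk.comp measurable_snd.snd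
  unfold crowdSummand
  exact ((measurable_crowdWeightApprox R i k l m).comp measurable_snd.fst).mul (h1.sub h2).norm

end Crowd

/-! ## §2 The crowded activity on the good set as a limit of continuous collision pair sums -/

section Crux

variable {σ : ℝ} {N : ℕ}

/-- **The crowded activity as a limit.** On the good set, `Fcr_i(z)` is the limit, as the rank
`m → ∞`, of `(σ/τ) ·` the collision pair sums over the window of the continuous rank-`m` summands
`crowdSummand (3ε) i m` evaluated at `(t, Φ_t z, Φ_{t⁻} z)`: both are finite sums over the collisions
of the orbit in the window, the recorded pre-collisional velocity is the left limit
(`IsHardSphereTrajectory.ofConfig_preVel_eq_leftLim`), and the crowding weights converge to the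
crowding indicator (`tendsto_crowdWeightApprox`). -/
theorem tendsto_collisionPairSum_crowdSummand (Φ : Flow σ N) {z : Cfg N} (hz : z ∈ Φ.good)
    (τ s : ℝ) (i : Fin (N + 1)) :
    Tendsto (fun m => σ / τ * collisionPairSum (Torus.geometry (Fin 3)) (hsDiameter σ N)
        (fun t => Φ.flow t z) (Ioc s (s + window τ N))
        (fun t k l => crowdSummand (3 * hsDiameter σ N) i m k l
          (t, Φ.flow t z, leftLim (fun t' => Φ.flow t' z) t))) atTop
      (𝓝 (crowdedActivity Φ τ s i z)) := by
  have hγ := Φ.isTrajectory z hz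
  have hfin : (collisionTimes (Torus.geometry (Fin 3)) (hsDiameter σ N) (fun t => Φ.flow t z) ∩
      Ioc s (s + window τ N)).Finite := Φ.finite_collisionTimes_inter hz Ioc_subset_Icc_self
  unfold crowdedActivity HardSphereFlow.collisionPairSum
  simp only [collisionPairSum_eq_finset_sum hfin]
  refine Tendsto.const_mul (σ / τ)
    (tendsto_finsetSum _ fun t _ => tendsto_finsetSum _ fun p hp => ?_)
  obtain ⟨k, l⟩ := p
  dsimp only
  rw [hγ.ofConfig_preVel_eq_leftLim hp]
  simp only [HardSphereCollisionRecord.ofConfig_postVel]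
  unfold crowdSummand
  dsimp only
  convert (tendsto_crowdWeightApprox (3 * hsDiameter σ N) i k l (Φ.flow t z)).mul_const
    ‖(Φ.flow t z k).2 - (leftLim (fun t' => Φ.flow t' z) t k).2‖ using 2
  split_ifs <;> simp

/-- **Measurability of the crowded activity in the initial datum.** For every flow, window and
tagged sphere, `Fcr_i`, extended by `0` off the good set, is a measurable function of the initial
datum: the pointwise limit (`tendsto_collisionPairSum_crowdSummand`) of measurable functions
(`measurable_indicator_collisionPairSum_cfg_torus` of the engine file `…CollisionActivityTailsCfgCollisionSums`:
contact on `𝕋³` is symmetric at every diameter, so no hypothesis on `σ`). -/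
theorem measurable_indicator_crowdedActivity (Φ : Flow σ N) (τ s : ℝ) (i : Fin (N + 1)) :
    Measurable (Φ.good.indicator (crowdedActivity Φ τ s i)) := by
  have hmeas : ∀ m : ℕ, Measurable fun z => σ / τ * Φ.good.indicator (fun z =>
      collisionPairSum (Torus.geometry (Fin 3)) (hsDiameter σ N) (fun t => Φ.flow t z)
        (Ioc s (s + window τ N)) (fun t k l => crowdSummand (3 * hsDiameter σ N) i m k l
          (t, Φ.flow t z, leftLim (fun t' => Φ.flow t' z) t))) z := fun m =>
    (measurable_indicator_collisionPairSum_cfg_torus Φ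
      (fun k l => continuous_crowdSummand (3 * hsDiameter σ N) i m k l)
      (fun k l => measurable_crowdSummand (3 * hsDiameter σ N) i m k l) s (s + window τ N)).const_mul _
  refine measurable_of_tendsto_metrizable hmeas ?_
  rw [tendsto_pi_nhds]
  intro z
  by_cases hz : z ∈ Φ.good
  · simp only [indicator_of_mem hz]
    exact tendsto_collisionPairSum_crowdSummand Φ hz τ s i
  · simp only [indicator_of_notMem hz, mul_zero]
    exact tendsto_const_nhds

end Crux

/-! ## §3 A.e.-measurability under the local Gibbs law; the tail sum -/

/-- The crowded collisional activity `Fcr_i` is an a.e.-measurable function of the initial datum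
for the local Gibbs law (which is carried by the good set of the flow, `localGibbsLaw_compl_good`). -/
theorem aemeasurable_crowdedActivity (σ : ℝ) (a₀ θ₀ : T3 → ℝ) (u₀ : T3 → V3) (N : ℕ)
    (Φ : Flow σ N) (τ s : ℝ) (i : Fin (N + 1)) :
    AEMeasurable (crowdedActivity Φ τ s i) (localGibbsLaw σ a₀ u₀ θ₀ N Φ) := by
  refine ⟨_, measurable_indicator_crowdedActivity Φ τ s i, ?_⟩
  filter_upwards [(mem_ae_iff.2 (localGibbsLaw_compl_good σ a₀ θ₀ u₀ N Φ) :
    ∀ᵐ z ∂(localGibbsLaw σ a₀ u₀ θ₀ N Φ), z ∈ Φ.good)] with z hz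
  exact (indicator_of_mem hz _).symm

/-- The tail `𝟙{M < Fcr_i} Fcr_i` of the crowded activity of one sphere is a.e.-measurable for the
local Gibbs law (`tailFn M` is measurable). -/
theorem aemeasurable_tailFn_crowdedActivity (σ : ℝ) (a₀ θ₀ : T3 → ℝ) (u₀ : T3 → V3) (N : ℕ)
    (Φ : Flow σ N) (τ s M : ℝ) (i : Fin (N + 1)) :
    AEMeasurable (fun z => tailFn M (crowdedActivity Φ τ s i z)) (localGibbsLaw σ a₀ u₀ θ₀ N Φ) :=
  (show Measurable (tailFn M) from
    measurable_id.indicator (measurableSet_lt measurable_const measurable_id)).comp_aemeasurable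
    (aemeasurable_crowdedActivity σ a₀ θ₀ u₀ N Φ τ s i)

/-- **Measurability conjunct of `stub_crowdedActivityUI` (line `SketchK1`).** For every reduced
diameter `σ`, all profiles, every `N`, every hard-sphere flow `Φ` of `N + 1` spheres on `𝕋³`, every
window length `τ`, start `s` and cut-off `M`, the tail sum `z ↦ Σ_i 𝟙{M < Fcr_i(z)} Fcr_i(z)` of the
crowded collisional activities is a.e.-measurable for the local Gibbs law `localGibbsLaw σ a₀ u₀ θ₀ N Φ`
— exactly the first conjunct of the registered statement `CrowdedActivityUI`, with no restriction on
`σ, τ, s, M`. -/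
theorem aemeasurable_sum_tailFn_crowdedActivity (σ : ℝ) (a₀ θ₀ : T3 → ℝ) (u₀ : T3 → V3) (N : ℕ)
    (Φ : Flow σ N) (τ s M : ℝ) :
    AEMeasurable (fun z => ∑ i : Fin (N + 1), tailFn M (crowdedActivity Φ τ s i z))
      (localGibbsLaw σ a₀ u₀ θ₀ N Φ) :=
  Finset.aemeasurable_fun_sum _ fun i _ => aemeasurable_tailFn_crowdedActivity σ a₀ θ₀ u₀ N Φ τ s M i


/-- **CROWDED ACTIVITY MEASURABILITY** — the measurability conjunct of the line's statement
`CrowdedActivityUI` (stub `stub_crowdedActivityUI`), split off as its own sub-goal and freed of every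
restriction: for every reduced diameter `σ`, all profiles, every `N`, every flow, every window length
`τ`, start `s` and cut-off `M`, the tail sum `z ↦ Σ_i 𝟙{M < Fcr_i(z)} Fcr_i(z)` is a.e.-measurable for
the local Gibbs law. -/
def CrowdedActivityMeasurable : Prop :=
  ∀ (σ : ℝ) (a₀ θ₀ : T3 → ℝ) (u₀ : T3 → V3) (N : ℕ) (Φ : Flow σ N) (τ s M : ℝ),
    AEMeasurable (fun z => ∑ i : Fin (N + 1), tailFn M (crowdedActivity Φ τ s i z))
      (localGibbsLaw σ a₀ u₀ θ₀ N Φ)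

/-- **STUB (measurability half of `stub_crowdedActivityUI`, line `SketchK1`).** The tail sum of the
crowded collisional activities is a.e.-measurable for the local Gibbs law, for all data
(`aemeasurable_sum_tailFn_crowdedActivity`). -/
theorem stub_crowdedActivityMeasurable : CrowdedActivityMeasurable :=
  aemeasurable_sum_tailFn_crowdedActivity

end Summit.AtomisticToContinuum.HydrodynamicLimit.Theorems.CollisionActivityTailsCrowdedActivityMeasurable

end
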